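import Literature.RingTheory.LocalCohomology.CechTwoOutOfThree
import Literature.RingTheory.LocalCohomology.CechDepthConverse
import Literature.RingTheory.LocalCohomology.CechBaseChange
import HarnessLib

/-!
# Vanishing of Čech local cohomology below a given degree: the predicate and its calculus

Topic `Literature/RingTheory/LocalCohomology`, sequel of `CechDepth.lean`, `CechDepthConverse.lean`,
`CechTwoOutOfThree.lean`, `CechBaseChange.lean`. Those files phrase "`Hⁱ_{(y)}(M) = 0` for all
`i < n`" as three elementwise clauses on the extended Čech complex
`0 → M → ∏ M_{y_i} → ∏ M_{y_iy_j} → ⋯` (injectivity of the augmentation, cocycles of `Č⁰` come from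
`M`, cocycles of `Č^{q+1}` are coboundaries). This file packages the three clauses into ONE predicate
`CechVanishBelow y M n` and records its calculus, so that the sequels (the Cohen–Macaulayness of
Kawasaki's blow-ups, Česnavičius 2021 Thm. 3.13 = Kawasaki 2000 Thm. 4.1) can manipulate local
cohomology vanishing as a single hypothesis:

* monotonicity, the trivial module, products, invariance under linear isomorphisms
  (`CechVanishBelow.of_equiv`) and under change of rings (`cechVanishBelow_yB_iff`, from
  `cechObjBaseChange`);
* the two-out-of-three transfers along a short exact sequence `0 → M' → M → M'' → 0`
  (`CechVanishBelow.mid/left/right`, wrapping `CechTwoOutOfThree.lean`);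
* vanishing in ALL degrees when some `r ∈ √(y)` acts bijectively on `M`
  (`CechVanishBelow.of_smul_bijective`: the classes are `r`-power torsion, `CechDepth.lean`);
* peeling a regular element `x ∈ √(y)` off: `M/xM` below `n` gives `M` below `n + 1`
  (`CechVanishBelow.of_quotSMulTop`) and conversely (`CechVanishBelow.quotSMulTop`, no membership
  needed) — SGA 2 III 3.3;
* the bridge with weakly regular sequences for finitely generated modules over Noetherian rings
  (`CechVanishBelow.of_isWeaklyRegular`, `CechVanishBelow.exists_isWeaklyRegular`) and hence the
  independence of the predicate from the chosen generators of the ideal up to radical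
  (`CechVanishBelow.of_span_le_radical`).

Everything is proved; no definitions beyond the predicate, no named facts.

## References

* [Grothendieck1968SGA2] A. Grothendieck, SGA 2, Exp. II–III (Prop. III.3.3), arXiv:math/0511279.
* [Eisenbud2005] D. Eisenbud, *The Geometry of Syzygies*, GTM 229, App. 1, Thm. A1.3, Prop. A1.16.
* [Cesnavicius2021] K. Česnavičius, *Macaulayfication of Noetherian schemes*, Duke Math. J. 170
  (2021), proof of Thm. 3.13 (where these manipulations are used).
-/

noncomputable section

universe u

namespace Literature.RingTheory.LocalCohomology

open RingTheory.Sequence Pointwise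

variable {R : Type u} [CommRing R] {s : ℕ} (y : Fin s → R) (M : Type u) [AddCommGroup M]
  [Module R M]

/-- **`Hⁱ_{(y)}(M) = 0` for all `i < n`**, in the three-clause Čech form of `CechDepth.lean`:
the augmentation `M → Č⁰(y;M)` is injective (if `0 < n`), every cocycle of `Č⁰` comes from `M`
(if `1 < n`), and every cocycle of `Č^{q+1}` is a coboundary (if `q + 2 < n`).
[cite: Grothendieck1968SGA2, Exp. III Prop. 3.3] -/
def CechVanishBelow (n : ℕ) : Prop :=
  (0 < n → ∀ m : M, cechAug y M m = 0 → m = 0) ∧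
  (1 < n → ∀ c : CechObj y M 0, dC 0 c = 0 → ∃ m : M, cechAug y M m = c) ∧
  (∀ q : ℕ, q + 2 < n → ∀ c : CechObj y M (q + 1), dC (q + 1) c = 0 →
    ∃ b : CechObj y M q, dC q b = c)

namespace CechVanishBelow

variable {y M}

/-- Nothing is required below `0`. [folklore] -/
theorem zero : CechVanishBelow y M 0 :=
  ⟨fun h => absurd h (lt_irrefl 0), fun h => absurd h (by omega), fun q h => absurd h (by omega)⟩

/-- Monotonicity in the bound. [folklore] -/
theorem mono {n n' : ℕ} (h : n ≤ n') (hv : CechVanishBelow y M n') : CechVanishBelow y M n :=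
  ⟨fun hn => hv.1 (lt_of_lt_of_le hn h), fun hn => hv.2.1 (lt_of_lt_of_le hn h),
    fun q hq => hv.2.2 q (lt_of_lt_of_le hq h)⟩

/-- The degree-`0` clause. [folklore] -/
theorem aug_injective {n : ℕ} (hv : CechVanishBelow y M n) (hn : 0 < n) (m : M)
    (hm : cechAug y M m = 0) : m = 0 :=
  hv.1 hn m hm

/-- The degree-`1` clause. [folklore] -/
theorem exact_zero {n : ℕ} (hv : CechVanishBelow y M n) (hn : 1 < n) (c : CechObj y M 0)
    (hc : dC 0 c = 0) : ∃ m : M, cechAug y M m = c :=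
  hv.2.1 hn c hc

/-- The clause in degrees `≥ 2`. [folklore] -/
theorem exact_succ {n : ℕ} (hv : CechVanishBelow y M n) (q : ℕ) (hq : q + 2 < n)
    (c : CechObj y M (q + 1)) (hc : dC (q + 1) c = 0) : ∃ b : CechObj y M q, dC q b = c :=
  hv.2.2 q hq c hc

/-- Below `1` only the injectivity of the augmentation is asked. [folklore] -/
theorem one_iff : CechVanishBelow y M 1 ↔ ∀ m : M, cechAug y M m = 0 → m = 0 :=
  ⟨fun h => h.1 one_pos, fun h => ⟨fun _ => h, fun h1 => absurd h1 (lt_irrefl 1),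
    fun q hq => absurd hq (by omega)⟩⟩

/-- How to raise the bound by one. [folklore] -/
theorem succ_iff {n : ℕ} : CechVanishBelow y M (n + 1) ↔
    CechVanishBelow y M n ∧
      (n = 0 → ∀ m : M, cechAug y M m = 0 → m = 0) ∧
      (n = 1 → ∀ c : CechObj y M 0, dC 0 c = 0 → ∃ m : M, cechAug y M m = c) ∧
      (∀ q : ℕ, n = q + 2 → ∀ c : CechObj y M (q + 1), dC (q + 1) c = 0 →
        ∃ b : CechObj y M q, dC q b = c) := by
  constructor
  · intro h
    refine ⟨h.mono (Nat.le_succ n), fun hn => h.1 (by omega), fun hn => h.2.1 (by omega),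
      fun q hq => h.2.2 q (by omega)⟩
  · rintro ⟨h, h0, h1, h2⟩
    refine ⟨fun _ => ?_, fun hn => ?_, fun q hq => ?_⟩
    · rcases Nat.eq_zero_or_pos n with rfl | hn
      · exact h0 rfl
      · exact h.1 hn
    · rcases Nat.lt_or_ge 1 n with hn' | hn'
      · exact h.2.1 hn'
      · exact h1 (by omega)
    · rcases Nat.lt_or_ge (q + 2) n with hq' | hq'
      · exact h.2.2 q hq'
      · exact h2 q (by omega)

/-! ## Subsingletons, products, isomorphisms -/

section Subsingleton

/-- The localisations of the zero module vanish. [folklore] -/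
theorem cechLoc_eq_zero [Subsingleton M] {n : ℕ} (t : Fin n → Fin s) (z : CechLoc y M t) : z = 0 := by
  induction z using LocalizedModule.induction_on with
  | h m k => rw [Subsingleton.elim m 0, LocalizedModule.zero_mk]

/-- The Čech cochains of the zero module vanish. [folklore] -/
theorem cechObj_eq_zero [Subsingleton M] (n : ℕ) (c : CechObj y M n) : c = 0 :=
  funext fun t => cechLoc_eq_zero t (c t)

/-- **The zero module has no local cohomology.** [folklore] -/
theorem of_subsingleton [Subsingleton M] (n : ℕ) : CechVanishBelow y M n :=
  ⟨fun _ m _ => Subsingleton.elim m 0,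
    fun _ c _ => ⟨0, by rw [map_zero, cechObj_eq_zero 0 c]⟩,
    fun q _ c _ => ⟨0, by rw [map_zero, cechObj_eq_zero (q + 1) c]⟩⟩

end Subsingleton

section TwoOutOfThree

variable {M' M'' : Type u} [AddCommGroup M'] [Module R M'] [AddCommGroup M''] [Module R M'']
  {φ : M' →ₗ[R] M} {ψ : M →ₗ[R] M''}

/-- **Two out of three, middle term**: along `0 → M' → M → M'' → 0`, `Hⁱ(M') = 0` and
`Hⁱ(M'') = 0` for `i < n` give `Hⁱ(M) = 0` for `i < n`. [cite: Grothendieck1968SGA2, Exp. III 3.3] -/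
theorem mid (hφ : Function.Injective φ) (hψ : Function.Surjective ψ) (hex : Function.Exact φ ψ)
    {n : ℕ} (h' : CechVanishBelow y M' n) (h'' : CechVanishBelow y M'' n) :
    CechVanishBelow y M n :=
  ⟨fun hn => cech_exact_mid_aug hφ hex (h'.1 hn) (h''.1 hn),
    fun hn => cech_exact_mid_zero hφ hψ hex (h'.2.1 hn) (h''.2.1 hn),
    fun q hq => cech_exact_mid_succ hφ hψ hex q (h'.2.2 q hq) (h''.2.2 q hq)⟩

/-- **Two out of three, right term**: along `0 → M' → M → M'' → 0`, `Hⁱ(M) = 0` for `i < n` and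
`Hⁱ(M') = 0` for `i < n + 1` give `Hⁱ(M'') = 0` for `i < n`.
[cite: Grothendieck1968SGA2, Exp. III 3.3] -/
theorem right (hφ : Function.Injective φ) (hψ : Function.Surjective ψ) (hex : Function.Exact φ ψ)
    {n : ℕ} (h : CechVanishBelow y M n) (h' : CechVanishBelow y M' (n + 1)) :
    CechVanishBelow y M'' n :=
  ⟨fun hn => cech_exact_right_aug hφ hψ hex (h.1 hn) (h'.2.1 (by omega)),
    fun hn => cech_exact_right_zero hφ hψ hex (h.2.1 hn) (h'.2.2 0 (by omega)),
    fun q hq => cech_exact_right_succ hφ hψ hex q (h.2.2 q hq) (h'.2.2 (q + 1) (by omega))⟩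

/-- **Two out of three, left term**: along `0 → M' → M → M'' → 0`, `Hⁱ(M'') = 0` for `i < n` and
`Hⁱ(M) = 0` for `i < n + 1` give `Hⁱ(M') = 0` for `i < n + 1`.
[cite: Grothendieck1968SGA2, Exp. III 3.3] -/
theorem left (hφ : Function.Injective φ) (hψ : Function.Surjective ψ) (hex : Function.Exact φ ψ)
    {n : ℕ} (h'' : CechVanishBelow y M'' n) (h : CechVanishBelow y M (n + 1)) :
    CechVanishBelow y M' (n + 1) := by
  refine ⟨fun hn => cech_exact_left_aug hφ (h.1 hn), fun hn => ?_, fun q hq => ?_⟩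
  · exact cech_exact_left_zero hφ hex (h''.1 (by omega)) (h.2.1 hn)
  · cases q with
    | zero => exact cech_exact_left_one hφ hψ hex (h''.2.1 (by omega)) (h.2.2 0 hq)
    | succ q => exact cech_exact_left_succ hφ hψ hex q (h''.2.2 q (by omega)) (h.2.2 (q + 1) hq)

/-- **Two out of three, left term, all degrees**: if `Č(y; M)` has no cohomology at all then
`Hⁱ(M') = 0` for `i < n + 1` as soon as `Hⁱ(M'') = 0` for `i < n` (the connecting isomorphisms
`Hⁱ(M'') ≅ Hⁱ⁺¹(M')`, vanishing form). [cite: Grothendieck1968SGA2, Exp. III 3.3] -/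
theorem left_of_forall (hφ : Function.Injective φ) (hψ : Function.Surjective ψ)
    (hex : Function.Exact φ ψ) (h : ∀ k, CechVanishBelow y M k) {n : ℕ}
    (h'' : CechVanishBelow y M'' n) : CechVanishBelow y M' (n + 1) :=
  left hφ hψ hex h'' (h (n + 1))

/-- **Two out of three, right term, all degrees**: if `Č(y; M)` has no cohomology at all then
`Hⁱ(M'') = 0` for `i < n` as soon as `Hⁱ(M') = 0` for `i < n + 1`.
[cite: Grothendieck1968SGA2, Exp. III 3.3] -/
theorem right_of_forall (hφ : Function.Injective φ) (hψ : Function.Surjective ψ)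
    (hex : Function.Exact φ ψ) (h : ∀ k, CechVanishBelow y M k) {n : ℕ}
    (h' : CechVanishBelow y M' (n + 1)) : CechVanishBelow y M'' n :=
  right hφ hψ hex (h n) h'

end TwoOutOfThree

section Equiv

variable {M' : Type u} [AddCommGroup M'] [Module R M']

/-- `0 → M → M' → 0 → 0` for a linear isomorphism, as an exact pair with the zero map to the zero
module. [folklore] -/
theorem exact_equiv_zero (e : M ≃ₗ[R] M') :
    Function.Exact e.toLinearMap (0 : M' →ₗ[R] PUnit.{u + 1}) := by
  intro m
  simp only [LinearMap.zero_apply, Set.mem_range, true_iff]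
  exact ⟨e.symm m, e.apply_symm_apply m⟩

/-- **Invariance under linear isomorphisms.** [folklore] -/
theorem of_equiv (e : M ≃ₗ[R] M') {n : ℕ} (h : CechVanishBelow y M n) : CechVanishBelow y M' n :=
  mid (φ := e.toLinearMap) (ψ := (0 : M' →ₗ[R] PUnit.{u + 1})) e.injective
    (fun _ => ⟨0, Subsingleton.elim _ _⟩) (exact_equiv_zero e) h (of_subsingleton n)

/-- Invariance under linear isomorphisms, `iff` form. [folklore] -/
theorem congr_equiv (e : M ≃ₗ[R] M') {n : ℕ} : CechVanishBelow y M n ↔ CechVanishBelow y M' n :=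
  ⟨of_equiv e, of_equiv e.symm⟩

/-- **Products**: `Hⁱ(M × M') = 0` below `n` if this holds for both factors.
[folklore] -/
theorem prod {n : ℕ} (h : CechVanishBelow y M n) (h' : CechVanishBelow y M' n) :
    CechVanishBelow y (M × M') n :=
  mid (φ := LinearMap.inl R M M') (ψ := LinearMap.snd R M M') LinearMap.inl_injective
    LinearMap.snd_surjective (fun ⟨a, b⟩ => by
      simp only [LinearMap.snd_apply, Set.mem_range, LinearMap.inl_apply, Prod.mk.injEq]
      constructor
      · rintro rfl; exact ⟨a, rfl, rfl⟩
      · rintro ⟨a', rfl, h⟩; exact h.symm) h h'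

/-- **Finite powers**: `Hⁱ(M^d) = 0` below `n` if `Hⁱ(M) = 0` below `n`. [folklore] -/
theorem pi_fin {n : ℕ} (h : CechVanishBelow y M n) : ∀ d : ℕ, CechVanishBelow y (Fin d → M) n
  | 0 => of_subsingleton n
  | d + 1 => (prod h (pi_fin h d)).of_equiv (Fin.consLinearEquiv R fun _ : Fin (d + 1) => M)

end Equiv

/-! ## Vanishing when an element of `√(y)` acts bijectively -/

section Bijective

/-- `r ↦ r • -` is surjective on each localisation if it is on `M`. [folklore] -/
theorem smul_surjective_cechLoc {r : R} (hr : Function.Surjective fun m : M => r • m) {n : ℕ}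
    (t : Fin n → Fin s) : Function.Surjective fun z : CechLoc y M t => r • z := by
  intro z
  induction z using LocalizedModule.induction_on with
  | h m k =>
    obtain ⟨m', hm'⟩ := hr m
    refine ⟨LocalizedModule.mk m' k, ?_⟩
    dsimp only at hm' ⊢
    rw [LocalizedModule.smul'_mk, hm']

/-- `r ↦ r • -` is surjective on the Čech cochains if it is on `M`. [folklore] -/
theorem smul_surjective_cechObj {r : R} (hr : Function.Surjective fun m : M => r • m) (n : ℕ) :
    Function.Surjective fun c : CechObj y M n => r • c := by
  intro c
  choose f hf using fun t => smul_surjective_cechLoc (y := y) hr t (c t)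
  exact ⟨f, funext fun t => by simpa using hf t⟩

/-- **If some `r ∈ √(y_1,…,y_s)` acts bijectively on `M`, then `Č(y; M)` is exact**: all the
local cohomology of `M` with supports in `V(y)` vanishes (the classes are `r`-power torsion).
[cite: Grothendieck1968SGA2, Exp. II; Eisenbud2005, Cor. A1.2] -/
theorem of_smul_bijective {r : R} (hr : r ∈ (Ideal.span (Set.range y)).radical)
    (hbij : Function.Bijective fun m : M => r • m) (n : ℕ) : CechVanishBelow y M n := by
  have hreg : IsSMulRegular M r := fun a b h => hbij.1 h
  have hregK : ∀ K : ℕ, IsSMulRegular M (r ^ K) := fun K => hreg.pow K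
  have hsurK : ∀ (K q : ℕ), Function.Surjective fun c : CechObj y M q => r ^ K • c := by
    intro K q
    induction K with
    | zero => intro c; exact ⟨c, by simp⟩
    | succ K ih =>
      intro c
      obtain ⟨c', hc'⟩ := smul_surjective_cechObj (y := y) hbij.2 q c
      obtain ⟨c'', hc''⟩ := ih c'
      refine ⟨c'', ?_⟩
      dsimp only at hc' hc'' ⊢
      rw [pow_succ, mul_comm, mul_smul, hc'', hc']
  have hsurM : ∀ K : ℕ, Function.Surjective fun m : M => r ^ K • m := by
    intro K
    induction K with
    | zero => intro m; exact ⟨m, by simp⟩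
    | succ K ih =>
      intro m
      obtain ⟨m₁, hm₁⟩ := hbij.2 m
      obtain ⟨m₂, hm₂⟩ := ih m₁
      refine ⟨m₂, ?_⟩
      dsimp only at hm₁ hm₂ ⊢
      rw [pow_succ, mul_comm, mul_smul, hm₂, hm₁]
  refine ⟨fun _ m hm => ?_, fun _ c hc => ?_, fun q _ c hc => ?_⟩
  · obtain ⟨K, hK⟩ := exists_pow_smul_eq_zero_of_cechAug_eq_zero' m hm hr
    exact (hregK K) (by simpa using hK)
  · obtain ⟨K, m, hm⟩ := exists_pow_smul_eq_cechAug' c hc hr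
    obtain ⟨m', hm'⟩ := hsurM K m
    dsimp only at hm'
    refine ⟨m', isSMulRegular_cechObj (y := y) (hregK K) 0 ?_⟩
    show r ^ K • cechAug y M m' = r ^ K • c
    rw [← LinearMap.map_smul, hm', hm]
  · obtain ⟨K, b, hb⟩ := exists_pow_smul_eq_dC' q c hc hr
    obtain ⟨b', hb'⟩ := hsurK K q b
    dsimp only at hb'
    refine ⟨b', isSMulRegular_cechObj (y := y) (hregK K) (q + 1) ?_⟩
    show r ^ K • dC q b' = r ^ K • c
    rw [← LinearMap.map_smul, hb', hb]

/-- **If some `r ∈ (y_1,…,y_s)` is a unit on `M`** (e.g. `M` is a module over `R[1/r]`), then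
`Hⁱ_{(y)}(M) = 0` for all `i`. [cite: Eisenbud2005, Cor. A1.2] -/
theorem of_isUnit_smul {r : R} (hr : r ∈ (Ideal.span (Set.range y)).radical)
    (hu : IsUnit ((algebraMap R (Module.End R M)) r)) (n : ℕ) : CechVanishBelow y M n :=
  of_smul_bijective hr ((Module.End.isUnit_iff _).mp hu) n

end Bijective

/-! ## Peeling a regular element -/

section Peel

variable {x : R}

/-- **From `M/xM` to `M`** (SGA 2 III 3.3, inductive step): if `x ∈ √(y)` is `M`-regular and
`Hⁱ(M/xM) = 0` for `i < n`, then `Hⁱ(M) = 0` for `i < n + 1`.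
[cite: Grothendieck1968SGA2, Exp. III Prop. 3.3] -/
theorem of_quotSMulTop (hx : IsSMulRegular M x) (hxy : x ∈ (Ideal.span (Set.range y)).radical)
    {n : ℕ} (h : CechVanishBelow y (QuotSMulTop x M) n) : CechVanishBelow y M (n + 1) := by
  refine ⟨fun _ m hm => ?_, fun hn c hc => ?_, fun q hq c hc => ?_⟩
  · obtain ⟨K, hK⟩ := exists_pow_smul_eq_zero_of_cechAug_eq_zero' m hm hxy
    exact (hx.pow K) (by simpa using hK)
  · obtain ⟨K, b, hb⟩ := exists_pow_smul_eq_cechAug' c hc hxy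
    obtain ⟨b', hb'⟩ := exists_eq_cechAug_of_pow_smul_eq hx (h.1 (by omega)) K c b hb
    exact ⟨b', hb'.symm⟩
  · obtain ⟨K, b, hb⟩ := exists_pow_smul_eq_dC' q c hc hxy
    cases q with
    | zero =>
      obtain ⟨b', hb'⟩ := exists_eq_dC_zero_of_pow_smul_eq hx (h.2.1 (by omega)) K c b hb
      exact ⟨b', hb'.symm⟩
    | succ q =>
      obtain ⟨b', hb'⟩ := exists_eq_dC_succ_of_pow_smul_eq hx q (h.2.2 q (by omega)) K c b hb
      exact ⟨b', hb'.symm⟩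

/-- **From `M` to `M/xM`** (SGA 2 III 3.3): if `x` is `M`-regular and `Hⁱ(M) = 0` for `i < n + 1`,
then `Hⁱ(M/xM) = 0` for `i < n` (no hypothesis `x ∈ √(y)`).
[cite: Grothendieck1968SGA2, Exp. III Prop. 3.3] -/
theorem quotSMulTop (hx : IsSMulRegular M x) {n : ℕ} (h : CechVanishBelow y M (n + 1)) :
    CechVanishBelow y (QuotSMulTop x M) n :=
  ⟨fun hn => cech_quot_aug_injective hx (h.1 (by omega)) (h.2.1 (by omega)),
    fun hn => cech_quot_exact_zero hx (h.2.1 (by omega)) (h.2.2 0 (by omega)),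
    fun q hq => cech_quot_exact_succ hx q (h.2.2 q (by omega)) (h.2.2 (q + 1) (by omega))⟩

/-- The quotient `M/xM ≅ M/P` for any submodule `P` with `P = xM` given as a set equality of
submodules, transported. [folklore] -/
theorem of_quotSMulTop_of_eq (hx : IsSMulRegular M x) (hxy : x ∈ (Ideal.span (Set.range y)).radical)
    {P : Submodule R M} (hP : P = x • ⊤) {n : ℕ} (h : CechVanishBelow y (M ⧸ P) n) :
    CechVanishBelow y M (n + 1) :=
  of_quotSMulTop hx hxy (h.of_equiv (Submodule.quotEquivOfEq _ _ hP))

end Peel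

/-! ## Weakly regular sequences -/

section Regular

/-- **`Hⁱ_{(y)}(M) = 0` below the length of a weakly `M`-regular sequence inside `√(y)`** (the
weakly-regular form of `cech_exact_of_isRegular`; no hypothesis `M ≠ (x)M`).
[cite: Grothendieck1968SGA2, Exp. III Prop. 3.3] [cite: Eisenbud2005, Prop. A1.16 (1)] -/
theorem of_isWeaklyRegular (rs : List R) :
    ∀ (M : Type u) [AddCommGroup M] [Module R M], IsWeaklyRegular M rs →
      (∀ r ∈ rs, r ∈ (Ideal.span (Set.range y)).radical) → CechVanishBelow y M rs.length := by
  induction rs with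
  | nil => intro M _ _ _ _; exact zero
  | cons x rs ih =>
    intro M _ _ hreg hrad
    rw [isWeaklyRegular_cons_iff] at hreg
    exact of_quotSMulTop hreg.1 (hrad x (by simp))
      (ih (QuotSMulTop x M) hreg.2 fun r hr => hrad r (by simp [hr]))

variable [IsNoetherianRing R] [Module.Finite R M]

/-- **A weakly regular sequence from the vanishing** (SGA 2 III 3.3, (iv) ⇒ (i)), for a finitely
generated module over a Noetherian ring: `Hⁱ_{(y)}(M) = 0` for `i < n` yields a weakly `M`-regular
sequence of length `n` inside the ideal `(y_1,…,y_s)`.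
[cite: Grothendieck1968SGA2, Exp. III Prop. 3.3] [cite: Eisenbud2005, Prop. A1.16] -/
theorem exists_isWeaklyRegular {n : ℕ} (h : CechVanishBelow y M n) :
    ∃ rs : List R, rs.length = n ∧ IsWeaklyRegular M rs ∧ ∀ r ∈ rs, r ∈ Ideal.span (Set.range y) :=
  exists_isWeaklyRegular_of_cech_exact n M h.1 h.2.1 h.2.2

/-- **Independence of the generators**: for a finitely generated module over a Noetherian ring the
vanishing below `n` only depends on the ideal `(y)` up to radical — if `(y) ⊆ √(y')` then vanishing
for `y` implies vanishing for `y'`. [cite: Grothendieck1968SGA2, Exp. III Prop. 3.3] -/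
theorem of_span_le_radical {s' : ℕ} {y' : Fin s' → R}
    (hle : Ideal.span (Set.range y) ≤ (Ideal.span (Set.range y')).radical) {n : ℕ}
    (h : CechVanishBelow y M n) : CechVanishBelow y' M n := by
  obtain ⟨rs, hlen, hreg, hmem⟩ := h.exists_isWeaklyRegular
  rw [← hlen]
  exact of_isWeaklyRegular rs M hreg fun r hr => hle (hmem r hr)

/-- Independence of the generators, for two generating families of the same ideal.
[cite: Grothendieck1968SGA2, Exp. III Prop. 3.3] -/
theorem of_span_eq {s' : ℕ} {y' : Fin s' → R}
    (heq : Ideal.span (Set.range y) = Ideal.span (Set.range y')) {n : ℕ}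
    (h : CechVanishBelow y M n) : CechVanishBelow y' M n :=
  h.of_span_le_radical (heq.le.trans Ideal.le_radical)

end Regular

end CechVanishBelow

/-! ## Change of rings -/

section BaseChange

variable (B : Type u) [CommRing B] [Algebra R B] [Module B M] [IsScalarTower R B M]

/-- **The vanishing may be computed over either ring**: for an `R`-algebra `B` and a `B`-module `M`,
`Hⁱ_{(y)}(M) = 0` below `n` over `R` iff `Hⁱ_{(ȳ)}(M) = 0` below `n` over `B`, `ȳ` the image
family (`cechObjBaseChange`). [cite: Grothendieck1968SGA2, Exp. II] -/
theorem cechVanishBelow_yB_iff {n : ℕ} : CechVanishBelow (yB B y) M n ↔ CechVanishBelow y M n := by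
  have haug : ∀ m : M, cechAug (yB B y) M m = cechObjBaseChange B y M 0 (cechAug y M m) :=
    fun m => (cechAug_cechObjBaseChange B y M m).symm
  have hd : ∀ (q : ℕ) (c : CechObj y M q),
      dC q (cechObjBaseChange B y M q c) = cechObjBaseChange B y M (q + 1) (dC q c) :=
    fun q c => dC_cechObjBaseChange B y M q c
  constructor
  · rintro ⟨h0, h1, h2⟩
    refine ⟨fun hn m hm => h0 hn m (by rw [haug, hm, map_zero]), fun hn c hc => ?_,
      fun q hq c hc => ?_⟩
    · obtain ⟨m, hm⟩ := h1 hn (cechObjBaseChange B y M 0 c) (by rw [hd, hc, map_zero])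
      exact ⟨m, (cechObjBaseChange B y M 0).injective (by rw [← haug, hm])⟩
    · obtain ⟨b, hb⟩ := h2 q hq (cechObjBaseChange B y M (q + 1) c) (by rw [hd, hc, map_zero])
      refine ⟨(cechObjBaseChange B y M q).symm b, (cechObjBaseChange B y M (q + 1)).injective ?_⟩
      rw [← hd, LinearEquiv.apply_symm_apply, hb]
  · rintro ⟨h0, h1, h2⟩
    refine ⟨fun hn m hm => h0 hn m ?_, fun hn c hc => ?_, fun q hq c hc => ?_⟩
    · apply (cechObjBaseChange B y M 0).injective
      rw [← haug, hm, map_zero]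
    · obtain ⟨m, hm⟩ := h1 hn ((cechObjBaseChange B y M 0).symm c) (by
        apply (cechObjBaseChange B y M 1).injective
        rw [← hd, LinearEquiv.apply_symm_apply, hc, map_zero])
      exact ⟨m, by rw [haug, hm, LinearEquiv.apply_symm_apply]⟩
    · obtain ⟨b, hb⟩ := h2 q hq ((cechObjBaseChange B y M (q + 1)).symm c) (by
        apply (cechObjBaseChange B y M (q + 2)).injective
        rw [← hd, LinearEquiv.apply_symm_apply, hc, map_zero])
      exact ⟨cechObjBaseChange B y M q b, by rw [hd, hb, LinearEquiv.apply_symm_apply]⟩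

end BaseChange

end Literature.RingTheory.LocalCohomology

end
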